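import Mathlib.RingTheory.Jacobson.Ring
import Mathlib.Algebra.Polynomial.Lifts
import Mathlib.Algebra.Polynomial.FieldDivision
import Mathlib.RingTheory.Ideal.Quotient.Operations
import Mathlib.RingTheory.FiniteType
import HarnessLib

/-!
# Maximal ideals of `A[T]` over the closed fibre of a finite-type algebra over a local ring

Topic: `Literature/RingTheory/Nullstellensatz`. Two classical facts about the maximal ideals
`𝔑 ⊆ A[T]`, used to describe the closed points of the charts `Spec A[a/b] ⊆ Bl_{(a,b)}(Spec A)`
of a blowing up in the proof of Kawasaki's theorem on Cohen–Macaulay blow-ups (Česnavičius 2021,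
proof of Thm. 3.13: "we may assume that `R''` is the localization of the subring
`R'[r_a/r_b] ⊂ R'[1/r_b]` at a maximal ideal whose `R'`-preimage is `𝔪'`. Explicitly, since each
maximal ideal of `(R'/𝔪')[T]` is generated by a monic polynomial, there is a monic `f(T) ∈ R'[T]`
such that … the preimage of `𝔪''` in `R'[T]` [is] generated by `𝔪'` and `f(T)`"):

* `isMaximal_comap_C_of_map_le` — **Zariski / Nullstellensatz form**: if `A` is of finite type
  over `R`, `𝔪 ⊆ R` is maximal and `𝔑 ⊆ A[T]` is a maximal ideal containing `𝔪 A[T]`, then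
  `𝔑 ∩ A` is maximal (`A/𝔪A` is Jacobson, being of finite type over the field `R/𝔪`, and
  Mathlib's `Polynomial.isMaximal_comap_C_of_isJacobsonRing`);
* `exists_monic_and_eq_sup_span` — if `𝔑 ⊆ A[T]` is maximal and `𝔓 = 𝔑 ∩ A` is maximal, then
  `𝔑 = 𝔓 A[T] + (f)` for a monic `f ∈ A[T]` (a lift of the monic generator of the maximal ideal
  `𝔑/𝔓[T]` of the principal ideal domain `(A/𝔓)[T]`);
* `exists_monic_and_span_cons_eq` — the same with generators: `𝔑 = (f, y_1, …, y_t)` if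
  `𝔓 = (y_1, …, y_t)`.

Everything is proved; no named facts.

## References

* [Cesnavicius2021] K. Česnavičius, *Macaulayfication of Noetherian schemes*, Duke Math. J. 170
  (2021), proof of Thm. 3.13.
* [AtiyahMacdonald1969] M. F. Atiyah, I. G. Macdonald, *Introduction to Commutative Algebra*,
  Cor. 5.24, Ex. 5.24–5.25 (Jacobson rings), Prop. 7.10.
* [StacksProject] The Stacks Project, Tags 00GB, 00FV.
-/

noncomputable section

namespace Literature.RingTheory.Nullstellensatz

open Polynomial Ideal

universe u v

variable {R : Type u} {A : Type v} [CommRing R] [CommRing A] [Algebra R A]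

/-- `C ∘ (R → A) = (R → A[T])`. [folklore] -/
theorem C_comp_algebraMap : (C : A →+* A[X]).comp (algebraMap R A) = algebraMap R A[X] :=
  RingHom.ext fun r => (Polynomial.algebraMap_apply r).symm

/-- The kernel of `A[T] → (A/I)[T]` lies in any ideal containing `I A[T]`. [folklore] -/
theorem ker_mapRingHom_mk_le {I : Ideal A} {𝔑 : Ideal A[X]} (h : I.map (C : A →+* A[X]) ≤ 𝔑) :
    RingHom.ker (mapRingHom (Ideal.Quotient.mk I)) ≤ 𝔑 := by
  rwa [ker_mapRingHom, Ideal.mk_ker]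

/-- Along a surjection whose kernel lies in `𝔑`, the image of the maximal ideal `𝔑` is maximal.
[folklore] -/
theorem isMaximal_map_of_surjective_of_ker_le {S : Type*} [CommRing S] (φ : A[X] →+* S)
    (hφ : Function.Surjective φ) {𝔑 : Ideal A[X]} [h𝔑 : 𝔑.IsMaximal]
    (hker : RingHom.ker φ ≤ 𝔑) : (𝔑.map φ).IsMaximal := by
  refine (map_eq_top_or_isMaximal_of_surjective φ hφ h𝔑).resolve_left fun htop => h𝔑.ne_top ?_
  have h := Ideal.comap_map_of_surjective φ hφ 𝔑
  rw [htop, Ideal.comap_top, ← RingHom.ker_eq_comap_bot, sup_eq_left.mpr hker] at h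
  exact h.symm

/-- **If `A` is of finite type over `R`, `𝔪 ⊆ R` is maximal and `𝔑 ⊆ A[T]` is a maximal ideal
containing `𝔪 A[T]`, then `𝔑 ∩ A` is a maximal ideal of `A`** (the fibre `A/𝔪A` is a Jacobson
ring, being of finite type over the field `R/𝔪`). [cite: AtiyahMacdonald1969, Ex. 5.24–5.25]
[cite: StacksProject, Tag 00GB] -/
theorem isMaximal_comap_C_of_map_le [Algebra.FiniteType R A] {𝔪 : Ideal R} [h𝔪 : 𝔪.IsMaximal]
    (𝔑 : Ideal A[X]) [h𝔑 : 𝔑.IsMaximal] (h : 𝔪.map (algebraMap R A[X]) ≤ 𝔑) :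
    (𝔑.comap (C : A →+* A[X])).IsMaximal := by
  set 𝔪A : Ideal A := 𝔪.map (algebraMap R A) with h𝔪A
  -- the fibre `A/𝔪A` is Jacobson
  haveI : IsJacobsonRing (A ⧸ 𝔪A) := by
    letI : Field (R ⧸ 𝔪) := Ideal.Quotient.field 𝔪
    letI : Algebra (R ⧸ 𝔪) (A ⧸ 𝔪A) :=
      Ideal.Quotient.algebraQuotientOfLEComap (Ideal.le_comap_map (f := algebraMap R A) (I := 𝔪))
    haveI : IsScalarTower R (R ⧸ 𝔪) (A ⧸ 𝔪A) := IsScalarTower.of_algebraMap_eq fun r => rfl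
    haveI : Algebra.FiniteType R (A ⧸ 𝔪A) :=
      Algebra.FiniteType.of_surjective (Ideal.Quotient.mkₐ R 𝔪A) Ideal.Quotient.mk_surjective
    haveI : Algebra.FiniteType (R ⧸ 𝔪) (A ⧸ 𝔪A) :=
      Algebra.FiniteType.of_restrictScalars_finiteType R (R ⧸ 𝔪) (A ⧸ 𝔪A)
    exact isJacobsonRing_of_finiteType (A := R ⧸ 𝔪)
  -- reduce modulo `𝔪A`
  set φ : A[X] →+* (A ⧸ 𝔪A)[X] := mapRingHom (Ideal.Quotient.mk 𝔪A) with hφ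
  have hφs : Function.Surjective φ := Polynomial.map_surjective _ Ideal.Quotient.mk_surjective
  have hker : RingHom.ker φ ≤ 𝔑 := by
    refine ker_mapRingHom_mk_le ?_
    rw [h𝔪A, Ideal.map_map, C_comp_algebraMap]
    exact h
  haveI h𝔑' : (𝔑.map φ).IsMaximal := isMaximal_map_of_surjective_of_ker_le φ hφs hker
  have hC : ((𝔑.map φ).comap (C : A ⧸ 𝔪A →+* (A ⧸ 𝔪A)[X])).IsMaximal :=
    Polynomial.isMaximal_comap_C_of_isJacobsonRing (P := 𝔑.map φ)
  -- `𝔑 ∩ A` is the preimage of `(𝔑 mod 𝔪A) ∩ (A/𝔪A)`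
  have key : 𝔑.comap (C : A →+* A[X]) =
      (((𝔑.map φ).comap (C : A ⧸ 𝔪A →+* (A ⧸ 𝔪A)[X])).comap (Ideal.Quotient.mk 𝔪A)) := by
    have hcomp : (C : A ⧸ 𝔪A →+* (A ⧸ 𝔪A)[X]).comp (Ideal.Quotient.mk 𝔪A) =
        φ.comp (C : A →+* A[X]) := by
      ext a
      simp [hφ]
    rw [Ideal.comap_comap, hcomp, ← Ideal.comap_comap, Ideal.comap_map_of_surjective φ hφs,
      ← RingHom.ker_eq_comap_bot, sup_eq_left.mpr hker]
  rw [key]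
  haveI := hC
  exact Ideal.comap_isMaximal_of_surjective _ Ideal.Quotient.mk_surjective

omit [Algebra R A] in
/-- **A maximal ideal of `A[T]` over a maximal ideal `𝔓` of `A` is `𝔓 A[T] + (f)` with `f`
monic**: `𝔑/𝔓[T]` is a maximal, hence nonzero principal, ideal of the principal ideal domain
`(A/𝔓)[T]`, generated by a monic polynomial, which lifts to a monic `f ∈ A[T]`.
[cite: Cesnavicius2021, proof of Thm. 3.13] [cite: StacksProject, Tag 00FV] -/
theorem exists_monic_and_eq_sup_span (𝔑 : Ideal A[X]) [h𝔑 : 𝔑.IsMaximal]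
    (h𝔓 : (𝔑.comap (C : A →+* A[X])).IsMaximal) :
    ∃ f : A[X], f.Monic ∧ 𝔑 = (𝔑.comap (C : A →+* A[X])).map C ⊔ Ideal.span {f} := by
  set 𝔓 := 𝔑.comap (C : A →+* A[X]) with h𝔓def
  letI : Field (A ⧸ 𝔓) := Ideal.Quotient.field 𝔓
  set ψ : A[X] →+* (A ⧸ 𝔓)[X] := mapRingHom (Ideal.Quotient.mk 𝔓) with hψ
  have hψs : Function.Surjective ψ := Polynomial.map_surjective _ Ideal.Quotient.mk_surjective
  have hkerψ : RingHom.ker ψ = 𝔓.map C := by rw [hψ, ker_mapRingHom, Ideal.mk_ker]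
  have hker : RingHom.ker ψ ≤ 𝔑 := by rw [hkerψ]; exact Ideal.map_comap_le
  haveI h𝔑' : (𝔑.map ψ).IsMaximal := isMaximal_map_of_surjective_of_ker_le ψ hψs hker
  -- a monic generator of the maximal ideal `𝔑 (A/𝔓)[T]`
  set p : (A ⧸ 𝔓)[X] := Submodule.IsPrincipal.generator (𝔑.map ψ) with hp
  have hspan : Ideal.span {p} = 𝔑.map ψ := Ideal.span_singleton_generator _
  have hp0 : p ≠ 0 := by
    intro h0
    rw [h0, Ideal.span_singleton_eq_bot.mpr rfl] at hspan
    have hbot : (⊥ : Ideal (A ⧸ 𝔓)[X]).IsMaximal := hspan ▸ h𝔑'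
    have := hbot.eq_of_le (Ideal.span_singleton_ne_top Polynomial.not_isUnit_X)
      bot_le
    exact Polynomial.X_ne_zero (Ideal.span_singleton_eq_bot.mp this.symm)
  set p₁ : (A ⧸ 𝔓)[X] := p * C (p.leadingCoeff)⁻¹ with hp₁
  have hp₁m : p₁.Monic := Polynomial.monic_mul_leadingCoeff_inv hp0
  have hspan₁ : Ideal.span {p₁} = 𝔑.map ψ := by
    rw [← hspan, hp₁]
    refine Ideal.span_singleton_mul_right_unit ?_ p
    exact isUnit_C.mpr (IsUnit.inv (isUnit_iff_ne_zero.mpr (leadingCoeff_ne_zero.mpr hp0)))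
  -- lift it to a monic `f`
  obtain ⟨f, hfmap, -, hfm⟩ :=
    Polynomial.lifts_and_degree_eq_and_monic
      (mem_lifts_of_surjective (f := Ideal.Quotient.mk 𝔓) Ideal.Quotient.mk_surjective p₁) hp₁m
  refine ⟨f, hfm, ?_⟩
  have h1 : 𝔑 = (𝔑.map ψ).comap ψ := by
    rw [Ideal.comap_map_of_surjective ψ hψs, ← RingHom.ker_eq_comap_bot, sup_eq_left.mpr hker]
  have h2 : 𝔑.map ψ = (Ideal.span {f}).map ψ := by
    rw [Ideal.map_span, Set.image_singleton, ← hspan₁, ← hfmap]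
    rfl
  rw [h1, h2, Ideal.comap_map_of_surjective ψ hψs, ← RingHom.ker_eq_comap_bot, hkerψ, sup_comm]

omit [Algebra R A] in
/-- **Generators**: with `𝔓 = 𝔑 ∩ A = (y_1, …, y_t)` maximal, `𝔑 = (f, y_1, …, y_t)` for a monic
`f ∈ A[T]`. [cite: Cesnavicius2021, proof of Thm. 3.13] -/
theorem exists_monic_and_span_cons_eq (𝔑 : Ideal A[X]) [h𝔑 : 𝔑.IsMaximal]
    (h𝔓 : (𝔑.comap (C : A →+* A[X])).IsMaximal) {t : ℕ} {y : Fin t → A}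
    (hy : Ideal.span (Set.range y) = 𝔑.comap (C : A →+* A[X])) :
    ∃ f : A[X], f.Monic ∧
      Ideal.span (Set.range (Fin.cons f (fun i => C (y i)) : Fin (t + 1) → A[X])) = 𝔑 := by
  obtain ⟨f, hfm, h𝔑eq⟩ := exists_monic_and_eq_sup_span 𝔑 h𝔓
  refine ⟨f, hfm, ?_⟩
  have hc : (fun i => C (y i)) = (C : A →+* A[X]) ∘ y := rfl
  conv_rhs => rw [h𝔑eq]
  rw [Fin.range_cons, Ideal.span_insert, hc, ← hy, Ideal.map_span, ← Set.range_comp, sup_comm]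

end Literature.RingTheory.Nullstellensatz

end
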